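import Summits.BirchSwinnertonDyer.BirchSwinnertonDyer.Theorems.QuadraticBranchSignedControlPlusEtaR1TamagawaRowShape
import Summits.BirchSwinnertonDyer.BirchSwinnertonDyer.Theorems.Rank1ResidualX11RankOneMinimality
import Summits.BirchSwinnertonDyer.Rank1Residual.Additive.IntModelTamagawaCertificate
import HarnessLib

/-!
# Route `QuadraticBranchSignedControl` (rung K8, cell `bsd-potss`), crux `PlusEtaLowerInclusion`
# (item stmt-BirchSwinnertonDyer-19601): the RANK-ONE TAMAGAWA ROWS, part 03 — (E⁺_η) ∧ (C1⁺_η) at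
# `p = 5` for every tower-onto good supersingular twist of each listed additive partner `W`, the two
# Tamagawa-`5` primes of `W` CERTIFIED IN THE KERNEL (seat `bsd-potss-k8eta-c1` g4; `--supports` 19601)

WHAT. g3's census (HOME/k8eta-c1/ETALEAD-TABLE-k8eta-c1-g3.tsv) lists 13 rank-one tower-onto rows of crux
19601 with `v_an = 1` and EXACTLY two Tamagawa-`5` primes `5 ∥ c_ℓ(W)`. The Tamagawa road (this seat:
`…TamagawaRoadCount` p513046, `…Duality` p514033, `…TamagawaRoad` p515151, record shape
`…PlusEtaR1TamagawaRowShape`) gives (E⁺_η)(V,5) ∧ (C1⁺_η)(V,5) at such a pair from the named facts, the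
`V`-side certificates and the arithmetic input `1 + rank W ≤ ∑ ord₅ c_ℓ(W) = 2`. THIS FILE instantiates
it per row: for each `W` (Cremona's minimal model) the rank-2 observatory's Tate-algorithm ROW CERTIFICATE
(`TamLocal.rowCheck`, kinds: `1` split multiplicative with a node-tangent root witness, `2`/`3` non-split,
`4`/`5` Tate certificates at additive primes; complete by `|Δ| = ∏ ℓⁿ`) is checked by `decide +kernel`,
global minimality by the bounded Kraus criterion, and `etaPair_of_rowCheck_of_tamagawaPair` is applied with
the two Tamagawa-`5` primes as `L`. Certificates: the observatory's engine
(`b2b/bsd-rank2-observatory/b2b-bsdr2-cert-2/kernel-tam3/engine1/tam.py`, unmodified) on the models of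
g3's `TAMAGAWA-40-k8eta-c1-g3.txt` (PARI), values cross-checked against PARI's `elllocalred`.

HONEST LABEL (cell `bsd-potss`, HUMAN RULING D-0036/D-0074/D-0088(2)): every row theorem is CONDITIONAL on
NAMED facts in hypothesis position (Kobayashi 2003 Thm. 1.2/1.3/2.2η/4.1η, Kitajima–Otsuki 2018 Thm. 1.3 at
`η`, Poitou–Tate = Milne I.4.10) and on DISPLAYED per-pair inputs: `rank W(ℚ) ≤ 1` (GZK on these
analytic-rank-one rows — NOT proved here), and on the twist `V`: `ρ_{V,5^m}` onto for all `m`, the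
`V`-certificate, and the ANALYTIC certificate `25 ∤ coeff₁ L_5⁺(V,η,T)` (g3's kit census: `v_an = 1`;
EVIDENCE tier, kernel for NO row). IN THE KERNEL per row: `Δ ≠ 0`, global minimality, the complete local
Tamagawa data of `W` at every bad prime. These are PER-ROW INSTANCES; the class-wide crux 19601 is OPEN and
NOT closed; nothing is booked; `BSD(W,5)` is claimed for no row. No `sorry`, no definition, axioms standard.

References: [Kobayashi2003] §4 Even MC + Thm. 4.1 (p. 8), Thm. 2.2 (p. 5); [KitajimaOtsuki2018] Thm. 1.3;
[MilneADT2006] I Thm. 4.10; [SilvermanATAEC1994] IV.9.4; [Cremona1997] Table 1; [Kraus1989].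
-/

set_option autoImplicit false
set_option linter.dupNamespace false

noncomputable section

open scoped Classical

open CongruenceSubgroup WeierstrassCurve
open Literature.NumberTheory.EllipticCurves
open Literature.NumberTheory.EllipticCurves.ModularForms
open Literature.NumberTheory.GaloisRepresentations
open Literature.NumberTheory.GaloisCohomology
open Summit.BirchSwinnertonDyer.Rank1Residual.Additive
open Summit.BirchSwinnertonDyer.BirchSwinnertonDyer.Rank2Observatory.Tam
open Summit.BirchSwinnertonDyer.BirchSwinnertonDyer.Rank1Residual.X11RankOne

namespace Summit.BirchSwinnertonDyer.BirchSwinnertonDyer.Theorems.PlusEtaR1TamagawaRows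


/-! ### `W = 311850cf1` -/

/-- The kernel ROW CERTIFICATE of `W = 311850cf1` (`[1, -1, 0, -38367, 6341041]`): `2`: In `n = 2`, kind 2 (non-split, exhaustion), `c = 2`; `3`: II `n = 4`, kind 4 (Tate Step-2 cert), `c = 1`; `5`: I0* `n = 6`, kind 5 (deep Tate cert), `c = 2` (certified set [1, 2, 4]); `7`: In `n = 5`, kind 1 (split, root witness), `c = 5`; `11`: In `n = 5`, kind 1 (split, root witness), `c = 5`; complete (`|Δ| = ∏ ℓⁿ`).
Engine `tam.py` (rank-2 observatory) unmodified; checked by `decide +kernel`. [cite: SilvermanATAEC1994, IV.9.4] [cite: Cremona1997, Table 1 (label 311850cf1)] -/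
theorem rowCheck_v311850cf1 : TamLocal.rowCheck [⟨2, 1, 2, 0, 0, 0, 0, 2, 0, 0, 2⟩, ⟨3, 1, 4, 0, 2, 0, 2, 4, 2, 1, 1⟩, ⟨5, 2, 5, 0, 4, 2, 23, 6, 6, 0, 2⟩, ⟨7, 2, 1, 4, 0, 0, 0, 5, 0, 0, 5⟩, ⟨11, 3, 1, 4, 0, 0, 0, 5, 0, 0, 5⟩] ⟨1, (-1), 0, (-38367), 6341041⟩ = true := by
  decide +kernel

set_option maxRecDepth 100000 in
/-- `W = 311850cf1` (`[1, -1, 0, -38367, 6341041]`) is a GLOBAL MINIMAL equation (bounded Kraus criterion on the literal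
coefficients). [cite: Kraus1989] [cite: SilvermanAEC2009, VII.1 Remark 1.1] -/
theorem isGloballyMinimal_v311850cf1 : (⟨1, (-1), 0, (-38367), 6341041⟩ : WeierstrassCurve ℚ).IsGloballyMinimal :=
  isGloballyMinimal_of_krausCriterion_bounded 1 (-1) 0 (-38367) 6341041
    (by decide +kernel) (by decide +kernel) (by decide +kernel)

/-- **(E⁺_η) ∧ (C1⁺_η) at `p = 5` for EVERY tower-onto good supersingular twist of `W = 311850cf1`** (Cremona's minimal
model `[1, -1, 0, -38367, 6341041]`, additive `I₀*` at `5`; its minimal `5`-twist `V` has conductor `12474`, good supersingular with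
`a_5(V) = 0`, `ρ_{V,5^∞}` onto, `r_an = 1` — a RANK-ONE TOWER-ONTO row of crux 19601's census; Tamagawa-`5`
primes `7:5, 11:5`, `v_an = 1` in g3's table). IN THE KERNEL: `Δ ≠ 0`, global minimality, the local Tamagawa
numbers of `W` at every bad prime (`rowCheck_v311850cf1`), hence `∑_T ord₅ c_ℓ(W) = 2` on `T = {7, 11}` and
`5 ∤ c_ℓ(W)` at every other `ℓ ≠ 5`. DISPLAYED: `rank W(ℚ) ≤ 1`; on `V`: tower onto, the `V`-certificate,
the analytic certificate `25 ∤ coeff₁ L_5⁺(V,η,T)`. CONDITIONAL on the named facts; a per-row instance; nothing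
booked; `BSD(W,5)` not claimed. [cite: Kobayashi2003, §4 Even main conjecture and Thm. 4.1 (p. 8)]
[cite: KitajimaOtsuki2018, Thm. 1.3] [cite: MilneADT2006, Ch. I, Thm. 4.10] [cite: Cremona1997, Table 1 (label 311850cf1)] -/
theorem etaPair_r1_v311850cf1_5
    (h12 : Kobayashi2003.thm12_signedSelmerDual_finite_torsion)
    (h13 : Kobayashi2003.thm41_signedCharIdeal_divisibility)
    (h22 : Kobayashi2003.thm22_etaSignedSelmerDual_finite_torsion)
    (h41 : Kobayashi2003.thm41_plusEtaCharIdeal_dvd)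
    (hKO : KitajimaOtsuki2018.mainThm13_etaSignedSelmerDual_noFiniteSubmodule)
    (hPT : poitouTate_selmerStructure_duality_real ℚ)
    (W : WeierstrassCurve ℚ) (hW : W = ⟨1, (-1), 0, (-38367), 6341041⟩)
    (hrW : W.mordellWeilRank ≤ 1)
    (V : WeierstrassCurve ℚ) [V.IsElliptic] [V.IsGloballyMinimal] [Fact (5 : ℕ).Prime]
    (C : VariableChange ℚ) (hCV : C • W.quadraticTwist 5 = V)
    (hgood : V.HasGoodReductionAtPrime 5) (hap : V.frobeniusTrace 5 = 0)
    (hsurj : ∀ m : ℕ, V.HasSurjectiveModNGaloisRep (5 ^ m : ℕ))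
    (hcertV : ∀ {N : ℕ} [NeZero N] (f : CuspForm (Gamma0 N) 2), IsNewformOf V f →
      ∃ L : IwasawaAlgebra 5, Kobayashi2003.IsSignedPAdicLFunction f 5 1 L ∧
        IsUnit (PowerSeries.coeff V.mordellWeilRank L))
    (han : ∀ {N : ℕ} [NeZero N] {f : CuspForm (Gamma0 N) 2}, IsNewformOf V f →
      ∀ (ϖ : ℚ), (if Even (5 / 2) then (ϖ : ℝ) * V.realPeriodRat = plusPeriod f
          else (ϖ : ℝ) * V.imaginaryPeriodRat = minusPeriod f) →
      ∀ (Lη : IwasawaAlgebra 5), IsQuadraticBranchPlusLFunction f 5 ϖ Lη →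
        ¬ (5 : ℤ_[5]) ^ 2 ∣ PowerSeries.coeff (V.quadraticTwist 5).mordellWeilRank Lη) :
    QuadraticBranchPlusEtaLowerInclusionAt V 5 ∧ QuadraticBranchPlusEtaMainConjectureAt V 5 := by
  subst hW
  have hb := IntModelTam.baseChange_rat_mk_int 1 (-1) 0 (-38367) 6341041
  haveI : ((⟨1, (-1), 0, (-38367), 6341041⟩ : WeierstrassCurve ℤ).baseChange ℚ).IsElliptic := TamLocal.isElliptic_of_rowCheck rowCheck_v311850cf1
  haveI : ((⟨1, (-1), 0, (-38367), 6341041⟩ : WeierstrassCurve ℤ).baseChange ℚ).IsGloballyMinimal := by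
    rw [hb]; exact isGloballyMinimal_v311850cf1
  have hD : ((-1 : ℚ) ^ ((5 : ℕ) / 2) * ((5 : ℕ) : ℚ)) = 5 := by norm_num
  refine etaPair_of_rowCheck_of_tamagawaPair h12 h13 h22 h41 hKO hPT (le_refl 5) rowCheck_v311850cf1
    [7, 11] (by decide) (by decide) (by decide) (by decide) (by decide) rfl (hrW := by rw [hb]; exact hrW) V C
    (by rw [hb, hD]; exact hCV) hgood hap hsurj (fun f hf => hcertV f hf) ?_
  intro N _ f hf ϖ hϖ Lη hL
  rw [hD]
  exact han hf ϖ hϖ Lη hL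

/-! ### `W = 345450go1` -/

/-- The kernel ROW CERTIFICATE of `W = 345450go1` (`[1, 0, 0, -202763, 34024017]`): `2`: In `n = 5`, kind 1 (split, root witness), `c = 5`; `3`: In `n = 5`, kind 1 (split, root witness), `c = 5`; `5`: I0* `n = 6`, kind 5 (deep Tate cert), `c = 2` (certified set [1, 2, 4]); `7`: IV* `n = 8`, kind 5 (deep Tate cert), `c = 3` (certified set [1, 3]); `47`: In `n = 1`, kind 3 (non-split, Euler witness), `c = 1`; complete (`|Δ| = ∏ ℓⁿ`).
Engine `tam.py` (rank-2 observatory) unmodified; checked by `decide +kernel`. [cite: SilvermanATAEC1994, IV.9.4] [cite: Cremona1997, Table 1 (label 345450go1)] -/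
theorem rowCheck_v345450go1 : TamLocal.rowCheck [⟨2, 1, 1, 0, 0, 0, 0, 5, 0, 0, 5⟩, ⟨3, 1, 1, 0, 0, 0, 0, 5, 0, 0, 5⟩, ⟨5, 2, 5, 0, 2, 2, 24, 6, 6, 0, 2⟩, ⟨7, 2, 5, 0, 4, 3, 47, 8, 8, 0, 3⟩, ⟨47, 6, 3, 0, 0, 0, 0, 1, 0, 0, 1⟩] ⟨1, 0, 0, (-202763), 34024017⟩ = true := by
  decide +kernel

set_option maxRecDepth 100000 in
/-- `W = 345450go1` (`[1, 0, 0, -202763, 34024017]`) is a GLOBAL MINIMAL equation (bounded Kraus criterion on the literal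
coefficients). [cite: Kraus1989] [cite: SilvermanAEC2009, VII.1 Remark 1.1] -/
theorem isGloballyMinimal_v345450go1 : (⟨1, 0, 0, (-202763), 34024017⟩ : WeierstrassCurve ℚ).IsGloballyMinimal :=
  isGloballyMinimal_of_krausCriterion_bounded 1 0 0 (-202763) 34024017
    (by decide +kernel) (by decide +kernel) (by decide +kernel)

/-- **(E⁺_η) ∧ (C1⁺_η) at `p = 5` for EVERY tower-onto good supersingular twist of `W = 345450go1`** (Cremona's minimal
model `[1, 0, 0, -202763, 34024017]`, additive `I₀*` at `5`; its minimal `5`-twist `V` has conductor `13818`, good supersingular with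
`a_5(V) = 0`, `ρ_{V,5^∞}` onto, `r_an = 1` — a RANK-ONE TOWER-ONTO row of crux 19601's census; Tamagawa-`5`
primes `2:5, 3:5`, `v_an = 1` in g3's table). IN THE KERNEL: `Δ ≠ 0`, global minimality, the local Tamagawa
numbers of `W` at every bad prime (`rowCheck_v345450go1`), hence `∑_T ord₅ c_ℓ(W) = 2` on `T = {2, 3}` and
`5 ∤ c_ℓ(W)` at every other `ℓ ≠ 5`. DISPLAYED: `rank W(ℚ) ≤ 1`; on `V`: tower onto, the `V`-certificate,
the analytic certificate `25 ∤ coeff₁ L_5⁺(V,η,T)`. CONDITIONAL on the named facts; a per-row instance; nothing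
booked; `BSD(W,5)` not claimed. [cite: Kobayashi2003, §4 Even main conjecture and Thm. 4.1 (p. 8)]
[cite: KitajimaOtsuki2018, Thm. 1.3] [cite: MilneADT2006, Ch. I, Thm. 4.10] [cite: Cremona1997, Table 1 (label 345450go1)] -/
theorem etaPair_r1_v345450go1_5
    (h12 : Kobayashi2003.thm12_signedSelmerDual_finite_torsion)
    (h13 : Kobayashi2003.thm41_signedCharIdeal_divisibility)
    (h22 : Kobayashi2003.thm22_etaSignedSelmerDual_finite_torsion)
    (h41 : Kobayashi2003.thm41_plusEtaCharIdeal_dvd)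
    (hKO : KitajimaOtsuki2018.mainThm13_etaSignedSelmerDual_noFiniteSubmodule)
    (hPT : poitouTate_selmerStructure_duality_real ℚ)
    (W : WeierstrassCurve ℚ) (hW : W = ⟨1, 0, 0, (-202763), 34024017⟩)
    (hrW : W.mordellWeilRank ≤ 1)
    (V : WeierstrassCurve ℚ) [V.IsElliptic] [V.IsGloballyMinimal] [Fact (5 : ℕ).Prime]
    (C : VariableChange ℚ) (hCV : C • W.quadraticTwist 5 = V)
    (hgood : V.HasGoodReductionAtPrime 5) (hap : V.frobeniusTrace 5 = 0)
    (hsurj : ∀ m : ℕ, V.HasSurjectiveModNGaloisRep (5 ^ m : ℕ))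
    (hcertV : ∀ {N : ℕ} [NeZero N] (f : CuspForm (Gamma0 N) 2), IsNewformOf V f →
      ∃ L : IwasawaAlgebra 5, Kobayashi2003.IsSignedPAdicLFunction f 5 1 L ∧
        IsUnit (PowerSeries.coeff V.mordellWeilRank L))
    (han : ∀ {N : ℕ} [NeZero N] {f : CuspForm (Gamma0 N) 2}, IsNewformOf V f →
      ∀ (ϖ : ℚ), (if Even (5 / 2) then (ϖ : ℝ) * V.realPeriodRat = plusPeriod f
          else (ϖ : ℝ) * V.imaginaryPeriodRat = minusPeriod f) →
      ∀ (Lη : IwasawaAlgebra 5), IsQuadraticBranchPlusLFunction f 5 ϖ Lη →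
        ¬ (5 : ℤ_[5]) ^ 2 ∣ PowerSeries.coeff (V.quadraticTwist 5).mordellWeilRank Lη) :
    QuadraticBranchPlusEtaLowerInclusionAt V 5 ∧ QuadraticBranchPlusEtaMainConjectureAt V 5 := by
  subst hW
  have hb := IntModelTam.baseChange_rat_mk_int 1 0 0 (-202763) 34024017
  haveI : ((⟨1, 0, 0, (-202763), 34024017⟩ : WeierstrassCurve ℤ).baseChange ℚ).IsElliptic := TamLocal.isElliptic_of_rowCheck rowCheck_v345450go1
  haveI : ((⟨1, 0, 0, (-202763), 34024017⟩ : WeierstrassCurve ℤ).baseChange ℚ).IsGloballyMinimal := by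
    rw [hb]; exact isGloballyMinimal_v345450go1
  have hD : ((-1 : ℚ) ^ ((5 : ℕ) / 2) * ((5 : ℕ) : ℚ)) = 5 := by norm_num
  refine etaPair_of_rowCheck_of_tamagawaPair h12 h13 h22 h41 hKO hPT (le_refl 5) rowCheck_v345450go1
    [2, 3] (by decide) (by decide) (by decide) (by decide) (by decide) rfl (hrW := by rw [hb]; exact hrW) V C
    (by rw [hb, hD]; exact hCV) hgood hap hsurj (fun f hf => hcertV f hf) ?_
  intro N _ f hf ϖ hϖ Lη hL
  rw [hD]
  exact han hf ϖ hϖ Lη hL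

/-! ### `W = 366450bp1` -/

/-- The kernel ROW CERTIFICATE of `W = 366450bp1` (`[1, 0, 0, 4362, 413892]`): `2`: In `n = 5`, kind 1 (split, root witness), `c = 5`; `3`: In `n = 3`, kind 1 (split, root witness), `c = 3`; `5`: I0* `n = 6`, kind 5 (deep Tate cert), `c = 2` (certified set [1, 2, 4]); `7`: In `n = 5`, kind 1 (split, root witness), `c = 5`; `349`: In `n = 1`, kind 1 (split, root witness), `c = 1`; complete (`|Δ| = ∏ ℓⁿ`).
Engine `tam.py` (rank-2 observatory) unmodified; checked by `decide +kernel`. [cite: SilvermanATAEC1994, IV.9.4] [cite: Cremona1997, Table 1 (label 366450bp1)] -/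
theorem rowCheck_v366450bp1 : TamLocal.rowCheck [⟨2, 1, 1, 0, 0, 0, 0, 5, 0, 0, 5⟩, ⟨3, 1, 1, 0, 0, 0, 0, 3, 0, 0, 3⟩, ⟨5, 2, 5, 0, 2, 2, 24, 6, 6, 0, 2⟩, ⟨7, 2, 1, 4, 0, 0, 0, 5, 0, 0, 5⟩, ⟨349, 18, 1, 146, 0, 0, 0, 1, 0, 0, 1⟩] ⟨1, 0, 0, 4362, 413892⟩ = true := by
  decide +kernel

set_option maxRecDepth 100000 in
/-- `W = 366450bp1` (`[1, 0, 0, 4362, 413892]`) is a GLOBAL MINIMAL equation (bounded Kraus criterion on the literal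
coefficients). [cite: Kraus1989] [cite: SilvermanAEC2009, VII.1 Remark 1.1] -/
theorem isGloballyMinimal_v366450bp1 : (⟨1, 0, 0, 4362, 413892⟩ : WeierstrassCurve ℚ).IsGloballyMinimal :=
  isGloballyMinimal_of_krausCriterion_bounded 1 0 0 4362 413892
    (by decide +kernel) (by decide +kernel) (by decide +kernel)

/-- **(E⁺_η) ∧ (C1⁺_η) at `p = 5` for EVERY tower-onto good supersingular twist of `W = 366450bp1`** (Cremona's minimal
model `[1, 0, 0, 4362, 413892]`, additive `I₀*` at `5`; its minimal `5`-twist `V` has conductor `14658`, good supersingular with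
`a_5(V) = 0`, `ρ_{V,5^∞}` onto, `r_an = 1` — a RANK-ONE TOWER-ONTO row of crux 19601's census; Tamagawa-`5`
primes `2:5, 7:5`, `v_an = 1` in g3's table). IN THE KERNEL: `Δ ≠ 0`, global minimality, the local Tamagawa
numbers of `W` at every bad prime (`rowCheck_v366450bp1`), hence `∑_T ord₅ c_ℓ(W) = 2` on `T = {2, 7}` and
`5 ∤ c_ℓ(W)` at every other `ℓ ≠ 5`. DISPLAYED: `rank W(ℚ) ≤ 1`; on `V`: tower onto, the `V`-certificate,
the analytic certificate `25 ∤ coeff₁ L_5⁺(V,η,T)`. CONDITIONAL on the named facts; a per-row instance; nothing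
booked; `BSD(W,5)` not claimed. [cite: Kobayashi2003, §4 Even main conjecture and Thm. 4.1 (p. 8)]
[cite: KitajimaOtsuki2018, Thm. 1.3] [cite: MilneADT2006, Ch. I, Thm. 4.10] [cite: Cremona1997, Table 1 (label 366450bp1)] -/
theorem etaPair_r1_v366450bp1_5
    (h12 : Kobayashi2003.thm12_signedSelmerDual_finite_torsion)
    (h13 : Kobayashi2003.thm41_signedCharIdeal_divisibility)
    (h22 : Kobayashi2003.thm22_etaSignedSelmerDual_finite_torsion)
    (h41 : Kobayashi2003.thm41_plusEtaCharIdeal_dvd)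
    (hKO : KitajimaOtsuki2018.mainThm13_etaSignedSelmerDual_noFiniteSubmodule)
    (hPT : poitouTate_selmerStructure_duality_real ℚ)
    (W : WeierstrassCurve ℚ) (hW : W = ⟨1, 0, 0, 4362, 413892⟩)
    (hrW : W.mordellWeilRank ≤ 1)
    (V : WeierstrassCurve ℚ) [V.IsElliptic] [V.IsGloballyMinimal] [Fact (5 : ℕ).Prime]
    (C : VariableChange ℚ) (hCV : C • W.quadraticTwist 5 = V)
    (hgood : V.HasGoodReductionAtPrime 5) (hap : V.frobeniusTrace 5 = 0)
    (hsurj : ∀ m : ℕ, V.HasSurjectiveModNGaloisRep (5 ^ m : ℕ))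
    (hcertV : ∀ {N : ℕ} [NeZero N] (f : CuspForm (Gamma0 N) 2), IsNewformOf V f →
      ∃ L : IwasawaAlgebra 5, Kobayashi2003.IsSignedPAdicLFunction f 5 1 L ∧
        IsUnit (PowerSeries.coeff V.mordellWeilRank L))
    (han : ∀ {N : ℕ} [NeZero N] {f : CuspForm (Gamma0 N) 2}, IsNewformOf V f →
      ∀ (ϖ : ℚ), (if Even (5 / 2) then (ϖ : ℝ) * V.realPeriodRat = plusPeriod f
          else (ϖ : ℝ) * V.imaginaryPeriodRat = minusPeriod f) →
      ∀ (Lη : IwasawaAlgebra 5), IsQuadraticBranchPlusLFunction f 5 ϖ Lη →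
        ¬ (5 : ℤ_[5]) ^ 2 ∣ PowerSeries.coeff (V.quadraticTwist 5).mordellWeilRank Lη) :
    QuadraticBranchPlusEtaLowerInclusionAt V 5 ∧ QuadraticBranchPlusEtaMainConjectureAt V 5 := by
  subst hW
  have hb := IntModelTam.baseChange_rat_mk_int 1 0 0 4362 413892
  haveI : ((⟨1, 0, 0, 4362, 413892⟩ : WeierstrassCurve ℤ).baseChange ℚ).IsElliptic := TamLocal.isElliptic_of_rowCheck rowCheck_v366450bp1
  haveI : ((⟨1, 0, 0, 4362, 413892⟩ : WeierstrassCurve ℤ).baseChange ℚ).IsGloballyMinimal := by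
    rw [hb]; exact isGloballyMinimal_v366450bp1
  have hD : ((-1 : ℚ) ^ ((5 : ℕ) / 2) * ((5 : ℕ) : ℚ)) = 5 := by norm_num
  refine etaPair_of_rowCheck_of_tamagawaPair h12 h13 h22 h41 hKO hPT (le_refl 5) rowCheck_v366450bp1
    [2, 7] (by decide) (by decide) (by decide) (by decide) (by decide) rfl (hrW := by rw [hb]; exact hrW) V C
    (by rw [hb, hD]; exact hCV) hgood hap hsurj (fun f hf => hcertV f hf) ?_
  intro N _ f hf ϖ hϖ Lη hL
  rw [hD]
  exact han hf ϖ hϖ Lη hL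

/-! ### `W = 460950m1` -/

/-- The kernel ROW CERTIFICATE of `W = 460950m1` (`[1, 0, 1, -49451, -5124202]`): `2`: In `n = 7`, kind 2 (non-split, exhaustion), `c = 1`; `3`: In `n = 5`, kind 1 (split, root witness), `c = 5`; `5`: I0* `n = 6`, kind 5 (deep Tate cert), `c = 2` (certified set [1, 2, 4]); `7`: In `n = 5`, kind 1 (split, root witness), `c = 5`; `439`: In `n = 1`, kind 3 (non-split, Euler witness), `c = 1`; complete (`|Δ| = ∏ ℓⁿ`).
Engine `tam.py` (rank-2 observatory) unmodified; checked by `decide +kernel`. [cite: SilvermanATAEC1994, IV.9.4] [cite: Cremona1997, Table 1 (label 460950m1)] -/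
theorem rowCheck_v460950m1 : TamLocal.rowCheck [⟨2, 1, 2, 0, 0, 0, 0, 7, 0, 0, 1⟩, ⟨3, 1, 1, 0, 0, 0, 0, 5, 0, 0, 5⟩, ⟨5, 2, 5, 0, 2, 2, 11, 6, 6, 0, 2⟩, ⟨7, 2, 1, 4, 0, 0, 0, 5, 0, 0, 5⟩, ⟨439, 20, 3, 0, 0, 0, 0, 1, 0, 0, 1⟩] ⟨1, 0, 1, (-49451), (-5124202)⟩ = true := by
  decide +kernel

set_option maxRecDepth 100000 in
/-- `W = 460950m1` (`[1, 0, 1, -49451, -5124202]`) is a GLOBAL MINIMAL equation (bounded Kraus criterion on the literal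
coefficients). [cite: Kraus1989] [cite: SilvermanAEC2009, VII.1 Remark 1.1] -/
theorem isGloballyMinimal_v460950m1 : (⟨1, 0, 1, (-49451), (-5124202)⟩ : WeierstrassCurve ℚ).IsGloballyMinimal :=
  isGloballyMinimal_of_krausCriterion_bounded 1 0 1 (-49451) (-5124202)
    (by decide +kernel) (by decide +kernel) (by decide +kernel)

/-- **(E⁺_η) ∧ (C1⁺_η) at `p = 5` for EVERY tower-onto good supersingular twist of `W = 460950m1`** (Cremona's minimal
model `[1, 0, 1, -49451, -5124202]`, additive `I₀*` at `5`; its minimal `5`-twist `V` has conductor `18438`, good supersingular with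
`a_5(V) = 0`, `ρ_{V,5^∞}` onto, `r_an = 1` — a RANK-ONE TOWER-ONTO row of crux 19601's census; Tamagawa-`5`
primes `3:5, 7:5`, `v_an = 1` in g3's table). IN THE KERNEL: `Δ ≠ 0`, global minimality, the local Tamagawa
numbers of `W` at every bad prime (`rowCheck_v460950m1`), hence `∑_T ord₅ c_ℓ(W) = 2` on `T = {3, 7}` and
`5 ∤ c_ℓ(W)` at every other `ℓ ≠ 5`. DISPLAYED: `rank W(ℚ) ≤ 1`; on `V`: tower onto, the `V`-certificate,
the analytic certificate `25 ∤ coeff₁ L_5⁺(V,η,T)`. CONDITIONAL on the named facts; a per-row instance; nothing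
booked; `BSD(W,5)` not claimed. [cite: Kobayashi2003, §4 Even main conjecture and Thm. 4.1 (p. 8)]
[cite: KitajimaOtsuki2018, Thm. 1.3] [cite: MilneADT2006, Ch. I, Thm. 4.10] [cite: Cremona1997, Table 1 (label 460950m1)] -/
theorem etaPair_r1_v460950m1_5
    (h12 : Kobayashi2003.thm12_signedSelmerDual_finite_torsion)
    (h13 : Kobayashi2003.thm41_signedCharIdeal_divisibility)
    (h22 : Kobayashi2003.thm22_etaSignedSelmerDual_finite_torsion)
    (h41 : Kobayashi2003.thm41_plusEtaCharIdeal_dvd)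
    (hKO : KitajimaOtsuki2018.mainThm13_etaSignedSelmerDual_noFiniteSubmodule)
    (hPT : poitouTate_selmerStructure_duality_real ℚ)
    (W : WeierstrassCurve ℚ) (hW : W = ⟨1, 0, 1, (-49451), (-5124202)⟩)
    (hrW : W.mordellWeilRank ≤ 1)
    (V : WeierstrassCurve ℚ) [V.IsElliptic] [V.IsGloballyMinimal] [Fact (5 : ℕ).Prime]
    (C : VariableChange ℚ) (hCV : C • W.quadraticTwist 5 = V)
    (hgood : V.HasGoodReductionAtPrime 5) (hap : V.frobeniusTrace 5 = 0)
    (hsurj : ∀ m : ℕ, V.HasSurjectiveModNGaloisRep (5 ^ m : ℕ))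
    (hcertV : ∀ {N : ℕ} [NeZero N] (f : CuspForm (Gamma0 N) 2), IsNewformOf V f →
      ∃ L : IwasawaAlgebra 5, Kobayashi2003.IsSignedPAdicLFunction f 5 1 L ∧
        IsUnit (PowerSeries.coeff V.mordellWeilRank L))
    (han : ∀ {N : ℕ} [NeZero N] {f : CuspForm (Gamma0 N) 2}, IsNewformOf V f →
      ∀ (ϖ : ℚ), (if Even (5 / 2) then (ϖ : ℝ) * V.realPeriodRat = plusPeriod f
          else (ϖ : ℝ) * V.imaginaryPeriodRat = minusPeriod f) →
      ∀ (Lη : IwasawaAlgebra 5), IsQuadraticBranchPlusLFunction f 5 ϖ Lη →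
        ¬ (5 : ℤ_[5]) ^ 2 ∣ PowerSeries.coeff (V.quadraticTwist 5).mordellWeilRank Lη) :
    QuadraticBranchPlusEtaLowerInclusionAt V 5 ∧ QuadraticBranchPlusEtaMainConjectureAt V 5 := by
  subst hW
  have hb := IntModelTam.baseChange_rat_mk_int 1 0 1 (-49451) (-5124202)
  haveI : ((⟨1, 0, 1, (-49451), (-5124202)⟩ : WeierstrassCurve ℤ).baseChange ℚ).IsElliptic := TamLocal.isElliptic_of_rowCheck rowCheck_v460950m1
  haveI : ((⟨1, 0, 1, (-49451), (-5124202)⟩ : WeierstrassCurve ℤ).baseChange ℚ).IsGloballyMinimal := by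
    rw [hb]; exact isGloballyMinimal_v460950m1
  have hD : ((-1 : ℚ) ^ ((5 : ℕ) / 2) * ((5 : ℕ) : ℚ)) = 5 := by norm_num
  refine etaPair_of_rowCheck_of_tamagawaPair h12 h13 h22 h41 hKO hPT (le_refl 5) rowCheck_v460950m1
    [3, 7] (by decide) (by decide) (by decide) (by decide) (by decide) rfl (hrW := by rw [hb]; exact hrW) V C
    (by rw [hb, hD]; exact hCV) hgood hap hsurj (fun f hf => hcertV f hf) ?_
  intro N _ f hf ϖ hϖ Lη hL
  rw [hD]
  exact han hf ϖ hϖ Lη hL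

end Summit.BirchSwinnertonDyer.BirchSwinnertonDyer.Theorems.PlusEtaR1TamagawaRows

end
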